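import Literature.NumberTheory.EllipticCurves.IwasawaTwistModPDual
import Literature.NumberTheory.EllipticCurves.IwasawaTwistModPTower
import HarnessLib

/-!
# K6 crux `MuTransferX9` (stmt-BirchSwinnertonDyer-19276), skeleton v5: the pure algebra of the core
# assembly — convolution coefficients against `U(S)·S^m`, the `T`-order of a truncation, and STEP 4's count

Cell `bsd-smallim`, seat `bsd-smallim-k6-c2` (gen 3). HONEST FRAMING: theorems only (no definition, no
named fact); nothing is asserted about any curve and nothing is booked. Generic lemmas used by the kernel
composition `stub_coreX9` ⟸ (`stub_selmerDualX9`, `stub_stepsTwoFourX9`, facts) of the registered BC3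
skeleton v5 (sha16 bbfcbeb8eb041500) of crux 19276 (sibling file `…X9CoreAssembly.lean`):

* convolution coefficients (tree `convCoeff`, file `IwasawaTwistModPDual`) of `S^j x` and of `U(S) x`
  for an integer polynomial `U` in the shift: `convCoeff_shiftEnd_pow_left_eq`,
  `convCoeff_zero_aeval_left`, `convCoeff_one_aeval_left`, `aeval_shiftEnd_pow_apply`, and the two
  lowest coefficients in coordinates (`convCoeff_zero_eq`, `convCoeff_one_eq`);
* `eq_zero_of_zsmul_eq_zero_of_not_dvd` (a `p`-torsion element killed by an integer prime to `p` is `0`),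
  `natCast_zsmul_muCarrier_eq_zero` (`μ_p` is `p`-torsion);
* `shiftEnd_pow_eq_shiftEmbed_shiftEnd_pow_castLE` (`S^{2e'+1} = embed ∘ S^{e'} ∘ trunc` on
  `Fin (2e'+2) → M`) and its cohomological consequence `shiftH1_iterate_truncate_ne_zero`: a class of
  `H¹(K, 𝒯_{2e'+2})` with `T^{2e'+1} ≠ 0` truncates to a class of `H¹(K, 𝒯_{e'+1})` with `T^{e'} ≠ 0`
  (MU-TRANSFER-PROOF §5 STEP 1: "`T^{e−1} y_e` lifts `s_c ≠ 0`");
* `convCoeff_zero_one_eq_zero_of_reciprocity` — STEP 4's count in coefficient form: if all coefficients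
  of index `i`, `i + ε < J`, of `(U(S)·S^m k, c)` vanish, `p ∤ U(0)`, the target is `p`-torsion and
  `m + 1 + ε < J`, then `C_0(k, c) = C_1(k, c) = 0`.

PARTITION (D-0054): X9 (A4) × p ∈ {5,7} — helper toward `stub_coreX9`; closes none.

References: HOME/koly/MU-TRANSFER-PROOF.md §5; B. Mazur, K. Rubin, *Kolyvagin systems*, Mem. AMS 799
(2004) Prop. 1.3.2, §4.4, §5.3 [MazurRubin2004]; L. Washington, *Introduction to Cyclotomic Fields*
§13.1–13.2 [Washington1997]; J.-P. Serre, *Galois Cohomology* II §1.2 [SerreGaloisCohomology1997].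
-/

set_option linter.dupNamespace false
set_option autoImplicit false

noncomputable section

open Literature.NumberTheory.GaloisRepresentations
open Literature.NumberTheory.EllipticCurves

namespace Summit.BirchSwinnertonDyer.BirchSwinnertonDyer.Rank1Residual.CoreAssembly

/-! ## Convolution coefficients against `S^j` and `U(S)` -/

section Helpers

variable {M M' P : Type*} [AddCommGroup M] [AddCommGroup M'] [AddCommGroup P]
  (e : M →+ M' →+ P) {J : ℕ}

/-- `C_k(S^j x, y) = C_{k−j}(x, y)` for `j ≤ k < J`, and `0` for `k < j` (iterate of
`convCoeff_succ_shiftEnd_left`). [cite: MazurRubin2004, §1.3 and §5.3] -/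
theorem convCoeff_shiftEnd_pow_left_eq (j : ℕ) {k : ℕ} (hk : k < J) (x : Fin J → M) (y : Fin J → M') :
    convCoeff e J k ((shiftEnd M J ^ j) x) y = if j ≤ k then convCoeff e J (k - j) x y else 0 := by
  induction j generalizing k with
  | zero => simp
  | succ j ih =>
    rw [pow_succ', Module.End.mul_apply]
    cases k with
    | zero => rw [convCoeff_zero_shiftEnd_left, if_neg (by omega)]
    | succ k =>
      rw [convCoeff_succ_shiftEnd_left e hk, ih (by omega)]
      by_cases h : j ≤ k
      · rw [if_pos h, if_pos (by omega), show k + 1 - (j + 1) = k - j by omega]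
      · rw [if_neg h, if_neg (by omega)]

/-- `C_0(U(S) x, y) = U(0) • C_0(x, y)` for an integer polynomial `U` in the shift.
[cite: MazurRubin2004, §1.3 and §5.3] -/
theorem convCoeff_zero_aeval_left (U : Polynomial ℤ) (x : Fin J → M) (y : Fin J → M') :
    convCoeff e J 0 (Polynomial.aeval (shiftEnd M J) U x) y = U.coeff 0 • convCoeff e J 0 x y := by
  have hU : Polynomial.aeval (shiftEnd M J) U x =
      U.coeff 0 • x + shiftEnd M J (Polynomial.aeval (shiftEnd M J) U.divX x) := by
    conv_lhs => rw [← Polynomial.X_mul_divX_add U]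
    rw [map_add, map_mul, Polynomial.aeval_X, Polynomial.aeval_C, LinearMap.add_apply,
      Module.End.mul_apply, Module.algebraMap_end_apply, add_comm]
  rw [hU, convCoeff_add_left, convCoeff_zero_shiftEnd_left, add_zero]
  exact map_zsmul ((convCoeffHom e J 0).flip y) (U.coeff 0) x

/-- `C_1(U(S) x, y) = U(0) • C_1(x, y) + U'(0) • C_0(x, y)`. [cite: MazurRubin2004, §1.3 and §5.3] -/
theorem convCoeff_one_aeval_left (hJ : 1 < J) (U : Polynomial ℤ) (x : Fin J → M) (y : Fin J → M') :
    convCoeff e J 1 (Polynomial.aeval (shiftEnd M J) U x) y =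
      U.coeff 0 • convCoeff e J 1 x y + U.coeff 1 • convCoeff e J 0 x y := by
  have hU : Polynomial.aeval (shiftEnd M J) U x =
      U.coeff 0 • x + shiftEnd M J (Polynomial.aeval (shiftEnd M J) U.divX x) := by
    conv_lhs => rw [← Polynomial.X_mul_divX_add U]
    rw [map_add, map_mul, Polynomial.aeval_X, Polynomial.aeval_C, LinearMap.add_apply,
      Module.End.mul_apply, Module.algebraMap_end_apply, add_comm]
  rw [hU, convCoeff_add_left, convCoeff_succ_shiftEnd_left e hJ,
    convCoeff_zero_aeval_left e, Polynomial.coeff_divX]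
  congr 1
  exact map_zsmul ((convCoeffHom e J 1).flip y) (U.coeff 0) x

/-- `U(S)` commutes with the powers of the shift. [cite: MazurRubin2004, §1.3 and §5.3] -/
theorem aeval_shiftEnd_pow_apply (U : Polynomial ℤ) (m : ℕ) (x : Fin J → M) :
    Polynomial.aeval (shiftEnd M J) U ((shiftEnd M J ^ m) x) =
      (shiftEnd M J ^ m) (Polynomial.aeval (shiftEnd M J) U x) := by
  have h1 : Polynomial.aeval (shiftEnd M J) (U * Polynomial.X ^ m) =
      Polynomial.aeval (shiftEnd M J) U * shiftEnd M J ^ m := by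
    rw [map_mul, map_pow, Polynomial.aeval_X]
  have h2 : Polynomial.aeval (shiftEnd M J) (Polynomial.X ^ m * U) =
      shiftEnd M J ^ m * Polynomial.aeval (shiftEnd M J) U := by
    rw [map_mul, map_pow, Polynomial.aeval_X]
  have h := h1.symm.trans ((congrArg _ (mul_comm _ _)).trans h2)
  exact LinearMap.congr_fun h x

/-- `C_0(x, y) = e(x_0, y_0)`. [cite: MazurRubin2004, §1.3 and §5.3] -/
theorem convCoeff_zero_eq (hJ : 0 < J) (x : Fin J → M) (y : Fin J → M') :
    convCoeff e J 0 x y = e (x ⟨0, hJ⟩) (y ⟨0, hJ⟩) := by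
  rw [convCoeff_def, Finset.sum_range_one, Nat.sub_zero, coeffFun_of_lt x hJ, coeffFun_of_lt y hJ]

/-- `C_1(x, y) = e(x_0, y_1) + e(x_1, y_0)`. [cite: MazurRubin2004, §1.3 and §5.3] -/
theorem convCoeff_one_eq (hJ : 1 < J) (x : Fin J → M) (y : Fin J → M') :
    convCoeff e J 1 x y = e (x ⟨0, by omega⟩) (y ⟨1, hJ⟩) + e (x ⟨1, hJ⟩) (y ⟨0, by omega⟩) := by
  rw [convCoeff_def, Finset.sum_range_succ, Finset.sum_range_one, Nat.sub_zero, Nat.sub_self,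
    coeffFun_of_lt x (by omega), coeffFun_of_lt y hJ, coeffFun_of_lt x hJ, coeffFun_of_lt y (by omega)]

/-- A `p`-torsion element killed by an integer prime to `p` is zero. [folklore] -/
theorem eq_zero_of_zsmul_eq_zero_of_not_dvd {p : ℕ} (hp : p.Prime) {c : P} (hpc : (p : ℤ) • c = 0)
    {u : ℤ} (hu : ¬ (p : ℤ) ∣ u) (huc : u • c = 0) : c = 0 := by
  have hcop : IsCoprime (p : ℤ) u :=
    (Nat.prime_iff_prime_int.mp hp).irreducible.coprime_iff_not_dvd.mpr hu
  obtain ⟨a, b, hab⟩ := hcop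
  calc c = (1 : ℤ) • c := (one_zsmul c).symm
    _ = (a * (p : ℤ) + b * u) • c := by rw [hab]
    _ = a • ((p : ℤ) • c) + b • (u • c) := by rw [add_smul, smul_smul, smul_smul]
    _ = 0 := by rw [hpc, huc, smul_zero, smul_zero, add_zero]

/-- `S^{2e'+1} x = T^{e'+1}·(S^{e'} (x mod T^{e'+1}))` on `Fin (2e'+2) → M`: the shift by `2e'+1` factors
as truncation to level `e'+1`, the shift by `e'` there, and the `T^{e'+1}`-embedding.
[cite: Washington1997, §13.1–§13.2] -/
theorem shiftEnd_pow_eq_shiftEmbed_shiftEnd_pow_castLE (e' : ℕ) (x : Fin (2 * e' + 1 + 1) → M) :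
    (shiftEnd M (2 * e' + 1 + 1) ^ (2 * e' + 1)) x =
      ZpExtension.shiftEmbed (2 * e' + 1 + 1) (show e' + 1 ≤ 2 * e' + 1 + 1 by omega)
        ((shiftEnd M (e' + 1) ^ e') (fun i => x (Fin.castLE (show e' + 1 ≤ 2 * e' + 1 + 1 by omega) i))) := by
  funext i
  simp only [shiftEnd_pow_apply, ZpExtension.shiftEmbed_apply]
  by_cases h1 : (i : ℕ) < 2 * e' + 1
  · rw [dif_pos h1]
    by_cases h2 : 2 * e' + 1 + 1 - (e' + 1) ≤ (i : ℕ)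
    · rw [dif_pos h2, dif_pos (by simp; omega)]
    · rw [dif_neg h2]
  · rw [dif_neg h1, dif_pos (by omega), dif_neg (by simp; omega)]
    congr 1
    ext
    simp only [Fin.val_castLE]
    omega

/-- `μ_p(ℚ̄)` (additively, `MuCarrier`) is killed by `p`: `ζ^p = 1`. [cite: SerreGaloisCohomology1997, II §1.2] -/
theorem natCast_zsmul_muCarrier_eq_zero (F : Type) [Field F] (n : ℕ)
    (ζ : DiscreteGaloisModule.MuCarrier F n) : (n : ℤ) • ζ = 0 := by
  rw [natCast_zsmul]
  apply (DiscreteGaloisModule.MuCarrier.toAdditive (K := F) (n := n)).injective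
  rw [map_nsmul, map_zero]
  apply Additive.toMul.injective
  rw [toMul_nsmul, toMul_zero]
  exact Subtype.ext ((mem_rootsOfUnity n _).mp (Additive.toMul (DiscreteGaloisModule.MuCarrier.toAdditive ζ)).2)

end Helpers

/-! ## Generic tower lemma: truncation to level `e` keeps `T`-order `≥ e` -/

section Trunc

variable {p : ℕ} [Fact p.Prime] (κ₁ : ZpExtension ℚ p) {M : Type} [AddCommGroup M]
  [TopologicalSpace M] [DiscreteTopology M] (ρ : DiscreteGaloisModule ℚ M) (hM : ∀ x : M, p • x = 0)

/-- If a class `Ψ ∈ H¹(K, 𝒯_{2e'+2})` has `T^{2e'+1} Ψ ≠ 0`, then its truncation `ψ` to level `e' + 1`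
has `T^{e'} ψ ≠ 0` — because `S^{2e'+1} = (T^{e'+1}-embedding) ∘ S^{e'} ∘ (truncation)`.
[cite: Washington1997, §13.1–§13.2] [cite: MazurRubin2004, §5.3] -/
theorem shiftH1_iterate_truncate_ne_zero (e' : ℕ)
    (Ψc : contOneCocycles (κ₁.twistModP ρ hM (2 * e' + 1 + 1)).toTopRep)
    (hΨT : (κ₁.shiftH1 ρ hM (2 * e' + 1 + 1))^[2 * e' + 1]
      (oneCocycleClass (κ₁.twistModP ρ hM (2 * e' + 1 + 1)).toTopRep Ψc) ≠ 0)
    (hle : e' + 1 ≤ 2 * e' + 1 + 1) :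
    (κ₁.shiftH1 ρ hM (e' + 1))^[e']
      (oneCocycleClass (κ₁.twistModP ρ hM (e' + 1)).toTopRep
        (κ₁.pushCocycle ρ hM (2 * e' + 1 + 1) (κ₁.twistModPTruncate ρ hM (2 * e' + 1 + 1) hle) Ψc)) ≠ 0 := by
  intro h0
  apply hΨT
  set ψ := κ₁.pushCocycle ρ hM (2 * e' + 1 + 1) (κ₁.twistModPTruncate ρ hM (2 * e' + 1 + 1) hle) Ψc
    with hψdef
  have h0' : (oneCocycleClass (κ₁.twistModP ρ hM (e' + 1)).toTopRep (κ₁.shiftPowCocycle ρ hM (e' + 1) e' ψ) :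
      galoisCohomology (κ₁.twistModP ρ hM (e' + 1)) 1) = 0 :=
    (ZpExtension.shiftH1_iterate_oneCocycleClass κ₁ ρ hM (e' + 1) e' ψ).symm.trans h0
  have h1 : galoisCohomology.map (κ₁.twistModPShiftEmbed ρ hM (2 * e' + 1 + 1) hle) 1
      (oneCocycleClass (κ₁.twistModP ρ hM (e' + 1)).toTopRep (κ₁.shiftPowCocycle ρ hM (e' + 1) e' ψ)) = 0 := by
    rw [h0']
    exact map_zero _
  rw [ZpExtension.map_oneCocycleClass_twist] at h1
  have h2 : κ₁.shiftPowCocycle ρ hM (2 * e' + 1 + 1) (2 * e' + 1) Ψc =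
      κ₁.pushCocycle ρ hM (e' + 1) (κ₁.twistModPShiftEmbed ρ hM (2 * e' + 1 + 1) hle)
        (κ₁.shiftPowCocycle ρ hM (e' + 1) e' ψ) :=
    Subtype.ext (ContinuousMap.ext fun σ => shiftEnd_pow_eq_shiftEmbed_shiftEnd_pow_castLE e' (Ψc.1 σ))
  have h3 : oneCocycleClass (κ₁.twistModP ρ hM (2 * e' + 1 + 1)).toTopRep
      (κ₁.shiftPowCocycle ρ hM (2 * e' + 1 + 1) (2 * e' + 1) Ψc) = 0 := by
    rw [h2]
    exact h1
  exact (ZpExtension.shiftH1_iterate_oneCocycleClass κ₁ ρ hM (2 * e' + 1 + 1) (2 * e' + 1) Ψc).trans h3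

end Trunc

/-! ## The count (pure algebra): reciprocity for a unit multiple kills the two lowest coefficients -/

section Count

variable {M M' P : Type*} [AddCommGroup M] [AddCommGroup M'] [AddCommGroup P]
  (e : M →+ M' →+ P) {J : ℕ}

/-- STEP 4's count: if every convolution coefficient of index `i` with `i + ε < J` of
`(U(S)·S^m k, c)` vanishes, `U(0)` is prime to `p`, `P` is `p`-torsion and `m + 1 + ε < J`, then
`C_0(k, c) = 0` and `C_1(k, c) = 0`. [cite: MazurRubin2004, Prop. 1.3.2, §4.4] -/
theorem convCoeff_zero_one_eq_zero_of_reciprocity {p : ℕ} (hp : p.Prime) (hP : ∀ c : P, (p : ℤ) • c = 0)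
    {m ε : ℕ} (hm : m + 1 + ε < J) (U : Polynomial ℤ) (hU : ¬ ((p : ℤ) ∣ U.coeff 0))
    (k : Fin J → M) (c : Fin J → M')
    (hrec : ∀ i : ℕ, i + ε < J →
      convCoeff e J i (Polynomial.aeval (shiftEnd M J) U ((shiftEnd M J ^ m) k)) c = 0) :
    convCoeff e J 0 k c = 0 ∧ convCoeff e J 1 k c = 0 := by
  have hr0 := hrec m (by omega)
  have hr1 := hrec (m + 1) (by omega)
  rw [aeval_shiftEnd_pow_apply, convCoeff_shiftEnd_pow_left_eq e _ (by omega), if_pos le_rfl,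
    Nat.sub_self, convCoeff_zero_aeval_left] at hr0
  rw [aeval_shiftEnd_pow_apply, convCoeff_shiftEnd_pow_left_eq e _ (by omega), if_pos (by omega),
    show m + 1 - m = 1 by omega, convCoeff_one_aeval_left e (by omega)] at hr1
  have hC0 : convCoeff e J 0 k c = 0 := eq_zero_of_zsmul_eq_zero_of_not_dvd hp (hP _) hU hr0
  rw [hC0, smul_zero, add_zero] at hr1
  exact ⟨hC0, eq_zero_of_zsmul_eq_zero_of_not_dvd hp (hP _) hU hr1⟩

end Count

end Summit.BirchSwinnertonDyer.BirchSwinnertonDyer.Rank1Residual.CoreAssembly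

end
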